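/-
Copyright (c) 2026 the pub-hodgecm-mathlib formalisation cell (harness21).  Prover seat hodgecm-mathlib-K2E4-p02 (g0), Track B ∕ K2-LIT
(build stream 29), h413 = `stmt-HodgeConjecture-24833`, line `K2_E4_SingularTransferKappaSign`, socket module «SplitDescent», file #2 — PAIR (part 2 of 3).  2026-09-03.
-/
import Summits.HodgeConjecture.HodgeConjecture.Theorems.K2E4ExplicitSplitConstantPhaseKit      -- ★ part 1 (K2E4-p02): local images of the singular pair, `𝟙_{K m K}`, non-negative orbital integrals
import Summits.HodgeConjecture.HodgeConjecture.Theorems.K2E4SingularPairIsLocalNormPair      -- ★ p854799 (K2E4-p05, pool H2): `singularPairIsLocalNormPair`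
import Literature.NumberTheory.Rogawski1990.FinExplicitTransferFactorSplitPlace              -- ★ `finExplicitDelta_eq_tau_mul_weyl_of_split` (`Δ‴_v = τ_v · D_{G∕H,v}` at a split place)
import Literature.NumberTheory.Rogawski1990.FinExplicitTransferFactorSplitPlaceTau           -- ★ `finTau_eq_localComponent_det_of_split` (`τ_v(γ_H) = μ_w(det g_w)`)
import Literature.NumberTheory.Rogawski1990.FinExplicitTransferFactorBoxReindex             -- ★ `finWeylRatio_eq_of_split_of_scalar` (`D_{G∕H,v}` at the block-scalar point)
import Literature.NumberTheory.Rogawski1990.UnitFundamentalLemmaSplitPlaceLeviSides         -- ★ `reindexGL_finSumFinEquiv_blockDiagGL_mem_glInt_iff` (`K_H = K₂ × K₁`)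
import Literature.NumberTheory.Automorphic.LocalEndoscopicOrbitClosed                        -- ★ `isGRegular_of_isStablyConjH`
import Literature.NumberTheory.Automorphic.LocalOrbitalMeasureRegular                       -- ★ `isInvInvariant_localEndoscopic` (`H_v` unimodular)
import Literature.NumberTheory.Automorphic.UnitaryGroupOfLocalCovolumeStableKit             -- ★ `ne_zero_of_quotientMeasure_ne_zero`
import Literature.NumberTheory.Automorphic.LocalUnitaryIntegralLevel                        -- ★ `isCompact_isOpen_cmLocalIntegralLevel` (`U(Φ_N)(𝒪_v)` compact open)
import Literature.MeasureTheory.Group.RightInvariantIsHaar                                  -- ★ `isHaarMeasure_of_isMulRightInvariant_of_ne_zero`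
import HarnessLib

/-!
# h413 ∕ Track B «K2-LIT», line `K2_E4_SingularTransferKappaSign`, socket #2 `sig_K2E4ExplicitSplitConstantPhase` — PAIR (part 2 of 3):
# the explicit transfer pair's value at `γ_{H,v}`, the explicit factor at the singular pair, and the Haar alternative for `νH v`

Cell `pub/hodgecm-mathlib`, crux H413 = `stmt-HodgeConjecture-24833`; chair K2-lead (g0), dealer K2E4-plan (g0); seat K2E4-p02.
THEOREMS ONLY (no `def`, no `instance`, no `notation`, no named fact, no `sorry`); lane `--supports stmt-HodgeConjecture-24833` (count-neutral helper).
Consumed by ★ `Theorems/K2E4ExplicitSplitConstantPhase` (part 3: socket #2 FROM socket #1).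

THE MATHEMATICS [Rogawski1990, §4.13 Lemma 4.13.1 (a) p. 64 (split transfer = twisted constant term), §4.9 p. 55 (`Δ_{G∕H} = τ D_{G∕H}`), §8.2 Prop. 8.2.1 (a) p. 118].
* §2′ for `f₀ = 𝟙_{e′⁻¹(K m_h K)}` (`m_h = diag(e₂ h.1, e₁ h.2)`, ★ `cmSplitLeviGL`): `f̄₀^P(h) = δ_P^{1∕2}(m_h) · μ_U{u | m_h u ∈ K m_h K} > 0`
  (`exists_cmConstantTermSplit_indicator_eq_pos`, over ★ `cmConstantTermSplit` and ★ `rootDeltaChar_standardParabolicGL_eq_sqrt_normAbs_det_boxAd`); `f₀ ∈ C_c^∞(G′_v)`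
  (`isLocSmooth_indicator_preimage_doubleCoset`); `0 < νG(K′)`, `0 < νH(K_H)` (`toReal_measure_cmSplitMaxCompact_pos`, `toReal_measure_cmSplitLeviCompact_pos`:
  compact open subgroups, `K_H = e₂⁻¹GL₂(𝒪_w) × e₁⁻¹GL₁(𝒪_w)` by ★ `reindexGL_finSumFinEquiv_blockDiagGL_mem_glInt_iff`).
* §3 at the singular pair `γ_H = (e₁·1₂, e₂) → γ₀` and a split place: `D_{G∕H,v}(γ_{H,v}) = ‖1 − e₁∕e₂‖_w² ‖e₁∕e₂‖_w⁻¹ > 0` (`finWeylRatio_singularPair_pos`) and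
  **`Δ‴_v(γ_{H,v}, γ_{0,v}) = μ_w(det(e₂ γ_{H,v}.1)) · D_{G∕H,v}(γ_{H,v})`** (`finExplicitDelta_singularPair_eq`: the pair matches by ★ H2 `singularPairIsLocalNormPair`, `χ_g(u)`
  is a unit by part 1, so ★ `finExplicitDelta_eq_tau_mul_weyl_of_split` (`κ_v = +1`) and ★ `finTau_eq_localComponent_det_of_split` apply; the character value is THE SAME
  one ★ `cmSplitTransfer` carries, through ★ `cmSplitEquivTwo` = `localSplitEquiv`).
* §4 `νH v` is bound by the frame only as «finite on compacta, right invariant»: if `νH v ≠ 0` it is HAAR (`isHaarMeasure_of_ne_zero`: `H_v` is unimodular,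
  ★ `isInvInvariant_localEndoscopic`, ★ `isHaarMeasure_of_isMulRightInvariant_of_ne_zero`); if `νH v = 0` every member of a CANONICAL family at a `G`-regular class is
  the Weil quotient of `0`, so every `G`-regular stable orbital integral vanishes (`stableOrbitalIntegralRel_eq_zero_of_measure_eq_zero`) and `(φ, 0)` is a `Δ_v`-transfer
  pair for EVERY `φ` and EVERY factor (`isLocalDeltaTransfer_zero_of_measure_eq_zero`); a smooth `φ` with `φ(x) = 1` exists at every point (`exists_isLocSmooth_apply_eq_one`:
  the indicator of `x · (U(Φ₂)(𝒪_v) × U(Φ₁)(𝒪_v))`).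

HONEST LABEL.  HC_CM is proved only modulo the 7 printed citations (2 remaining named inputs: hLiu418 = `stmt-HodgeConjecture-24832`, h413 = `stmt-HodgeConjecture-24833`)
until rung 0 closes; this file moves no counter.

## References
* [Rogawski1990] J. D. Rogawski, *Automorphic Representations of Unitary Groups in Three Variables*, Ann. of Math. Stud. 123 (1990): §4.4 p. 44, §4.9 p. 55,
  §4.13 Lemma 4.13.1 (a) pp. 64–66, §4.3 (4.3.1) p. 43, §8.2 Prop. 8.2.1 (a) p. 118, §1.7 p. 6.
* [DeitmarEchterhoff2014] A. Deitmar, S. Echterhoff, *Principles of Harmonic Analysis*, 2nd ed. (2014), Thm. 1.5.3.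
* [Folland1999] G. B. Folland, *Real Analysis*, 2nd ed. (1999), Thm. 11.9.
-/

set_option autoImplicit false
-- the mandated namespace repeats the single-problem summit's segment (`HodgeConjecture.HodgeConjecture`)
set_option linter.dupNamespace false

noncomputable section

open MeasureTheory Measure NumberField IsDedekindDomain TopologicalSpace
open Literature.MeasureTheory.Group Literature.MeasureTheory.RestrictedProduct
open Literature.Topology.RestrictedProduct Literature.Topology.Algebra.RestrictedProduct
open Literature.NumberTheory.Rogawski1990 Literature.NumberTheory.Automorphic Literature.NumberTheory.GaloisRepresentations
open Literature.AlgebraicGeometry.ShimuraVarieties (unitaryGroup hermForm)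
open scoped Matrix MatrixGroups RestrictedProduct NNReal ENNReal

namespace Summit.HodgeConjecture.HodgeConjecture.Cruxes.H413.K2E4ExplicitSplitConstantPhase

section ConstantTerm

variable (L : Type) [Field L] [NumberField L] [IsCMField L] (H' : Matrix (Fin 3) (Fin 3) L)
  (hH' : (H'.map (cmConjRingHom L))ᵀ = H') (hH'd : IsUnit H'.det)
  (v : HeightOneSpectrum (𝓞 ↥(maximalRealSubfield L))) (w : UnitaryGroup.PlacesOver L v) (hw : IsCMField.complexConj L • w.1 ≠ w.1)
  (h : (UnitaryGroup.cmDatum L 2 (Matrix.of fun i j : Fin 2 => if i.val + j.val + 1 = 2 then (1 : L) else 0)).Local v ×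
    (UnitaryGroup.cmDatum L 1 (Matrix.of fun i j : Fin 1 => if i.val + j.val + 1 = 1 then (1 : L) else 0)).Local v)

/-- **`f̄₀^P(h) > 0`** for `f₀ = 𝟙_{e′⁻¹(K m_h K)}` (★ `cmConstantTermSplit`: `δ_P^{1∕2}(m_h) · ∫_{K×U} f₀(e′⁻¹(k (m_h u) k⁻¹))`; `δ_P^{1∕2}(m_h) = ‖det K_{m_h}‖^{1∕2} > 0` by ★
`rootDeltaChar_standardParabolicGL_eq_sqrt_normAbs_det_boxAd`, and the integral is §2's positive real). [cite: Rogawski1990, §4.13 Lemma 4.13.1 (a) p. 64] -/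
theorem exists_cmConstantTermSplit_indicator_eq_pos :
    ∃ r : ℝ, 0 < r ∧ UnitaryGroup.cmConstantTermSplit L H' hH' hH'd v w hw
      ((UnitaryGroup.localSplitEquiv (IsCMField.complexConj L) H' (IsCMField.complexConj_ne_one L) ((UnitaryGroup.map_cmConjRingHom_eq_map_complexConj L H') ▸ hH') w hw
          (UnitaryGroup.isUnit_placeForm_of_isUnit_det hH'd w.1) ⁻¹'
        Set.image2 (fun a b : GL (Fin 3) (w.1.adicCompletion L) => a * UnitaryGroup.cmSplitLeviGL L v w hw h * b)
          ↑(glInt 3 (w.1.adicCompletion L)) ↑(glInt 3 (w.1.adicCompletion L))).indicator fun _ => (1 : ℂ)) h = (r : ℂ) := by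
  obtain ⟨r, hr, hint⟩ := exists_integral_indicator_doubleCoset_eq_pos (L := L) w.1 (UnitaryGroup.cmSplitLeviGL L v w hw h)
  -- the weight `δ_P^{1∕2}(m_h)`: a non-zero non-negative real
  set δ : ℂˣ := rootDeltaChar (standardParabolicGL (w.1.adicCompletion L) (Zelevinsky1980.lastBlockLabel 3))
    ⟨UnitaryGroup.cmSplitLeviGL L v w hw h, UnitaryGroup.cmSplitLeviGL_mem_standardParabolicGL L v w hw h⟩ with hδ
  obtain ⟨x, hx0, hx⟩ : ∃ x : ℝ, 0 ≤ x ∧ (δ : ℂ) = (x : ℂ) :=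
    ⟨_, Real.sqrt_nonneg _, by rw [hδ, rootDeltaChar_standardParabolicGL_eq_sqrt_normAbs_det_boxAd]⟩
  have hxne : x ≠ 0 := by
    intro h0
    apply δ.ne_zero
    rw [hx, h0, Complex.ofReal_zero]
  have hxpos : 0 < x := lt_of_le_of_ne hx0 (Ne.symm hxne)
  refine ⟨x * r, mul_pos hxpos hr, ?_⟩
  rw [UnitaryGroup.cmConstantTermSplit_apply, Complex.ofReal_mul, ← hx]
  congr 1
  -- the integrand: `f₀ (e′⁻¹ y) = 𝟙_{K m K}(y)`
  rw [← hint]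
  congr 1
  funext q
  exact indicator_const_preimage_symm_apply _ _ _ _

/-- **`f₀ = 𝟙_{e′⁻¹(K m K)}` is a test function** (`C_c^∞`: the indicator of a compact open subset of `G′_v`; ★ `isLocSmooth_indicator`). [cite: Rogawski1990, §1.6 p. 6] -/
theorem isLocSmooth_indicator_preimage_doubleCoset (m : GL (Fin 3) (w.1.adicCompletion L)) :
    IsLocSmooth ((UnitaryGroup.localSplitEquiv (IsCMField.complexConj L) H' (IsCMField.complexConj_ne_one L) ((UnitaryGroup.map_cmConjRingHom_eq_map_complexConj L H') ▸ hH') w hw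
          (UnitaryGroup.isUnit_placeForm_of_isUnit_det hH'd w.1) ⁻¹'
        Set.image2 (fun a b : GL (Fin 3) (w.1.adicCompletion L) => a * m * b) ↑(glInt 3 (w.1.adicCompletion L)) ↑(glInt 3 (w.1.adicCompletion L))).indicator
      fun _ => (1 : ℂ)) := by
  set e' := UnitaryGroup.localSplitEquiv (IsCMField.complexConj L) H' (IsCMField.complexConj_ne_one L) ((UnitaryGroup.map_cmConjRingHom_eq_map_complexConj L H') ▸ hH') w hw
    (UnitaryGroup.isUnit_placeForm_of_isUnit_det hH'd w.1) with he'
  haveI : T2Space (GL (Fin 3) (w.1.adicCompletion L)) := inferInstance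
  have hc : IsCompact (e' ⁻¹' Set.image2 (fun a b : GL (Fin 3) (w.1.adicCompletion L) => a * m * b) ↑(glInt 3 (w.1.adicCompletion L)) ↑(glInt 3 (w.1.adicCompletion L))) :=
    e'.toHomeomorph.isCompact_preimage.2 (isCompact_doubleCoset w.1 m)
  exact isLocSmooth_indicator ((isOpen_doubleCoset w.1 m).preimage e'.continuous) ((isCompact_doubleCoset w.1 m).isClosed.preimage e'.continuous) hc

/-- **`0 < νG(K′) < ∞`** for a Haar measure `νG` on `G′_v`: `K′ = e′⁻¹ GL₃(𝒪_w)` (★ `cmSplitMaxCompact`) is a compact open subgroup. [cite: Rogawski1990, §4.4 p. 44] -/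
theorem toReal_measure_cmSplitMaxCompact_pos [MeasurableSpace ((UnitaryGroup.cmDatum L 3 H').Local v)] [BorelSpace ((UnitaryGroup.cmDatum L 3 H').Local v)]
    (ν : Measure ((UnitaryGroup.cmDatum L 3 H').Local v)) [ν.IsHaarMeasure] :
    0 < (ν (UnitaryGroup.cmSplitMaxCompact L v w hw H' hH' hH'd)).toReal := by
  set e' := UnitaryGroup.localSplitEquiv (IsCMField.complexConj L) H' (IsCMField.complexConj_ne_one L) ((UnitaryGroup.map_cmConjRingHom_eq_map_complexConj L H') ▸ hH') w hw
    (UnitaryGroup.isUnit_placeForm_of_isUnit_det hH'd w.1) with he'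
  have hset : (UnitaryGroup.cmSplitMaxCompact L v w hw H' hH' hH'd : Set ((UnitaryGroup.cmDatum L 3 H').Local v)) =
      e' ⁻¹' (glInt 3 (w.1.adicCompletion L) : Set (GL (Fin 3) (w.1.adicCompletion L))) :=
    Set.ext fun g => UnitaryGroup.mem_cmSplitMaxCompact_iff L v w hw H' hH' hH'd g
  refine ENNReal.toReal_pos ?_ ?_
  · refine (IsOpen.measure_pos ν ?_ ⟨1, (UnitaryGroup.cmSplitMaxCompact L v w hw H' hH' hH'd).one_mem⟩).ne'
    rw [hset]; exact (isOpen_glInt 3 (w.1.adicCompletion L)).preimage e'.continuous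
  · refine (IsCompact.measure_lt_top ?_).ne
    rw [hset]; exact e'.toHomeomorph.isCompact_preimage.2 (isCompact_glInt 3 (w.1.adicCompletion L))

/-- **`0 < νH(K_H) < ∞`** for a Haar measure `νH` on `H_v`: `K_H = e₂⁻¹ GL₂(𝒪_w) × e₁⁻¹ GL₁(𝒪_w)` (★ `cmSplitLeviCompact`, ★ `reindexGL_finSumFinEquiv_blockDiagGL_mem_glInt_iff`)
is a compact open subgroup. [cite: Rogawski1990, §4.4 p. 44] -/
theorem toReal_measure_cmSplitLeviCompact_pos
    [MeasurableSpace ((UnitaryGroup.cmDatum L 2 (Matrix.of fun i j : Fin 2 => if i.val + j.val + 1 = 2 then (1 : L) else 0)).Local v ×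
      (UnitaryGroup.cmDatum L 1 (Matrix.of fun i j : Fin 1 => if i.val + j.val + 1 = 1 then (1 : L) else 0)).Local v)]
    [BorelSpace ((UnitaryGroup.cmDatum L 2 (Matrix.of fun i j : Fin 2 => if i.val + j.val + 1 = 2 then (1 : L) else 0)).Local v ×
      (UnitaryGroup.cmDatum L 1 (Matrix.of fun i j : Fin 1 => if i.val + j.val + 1 = 1 then (1 : L) else 0)).Local v)]
    (ν : Measure ((UnitaryGroup.cmDatum L 2 (Matrix.of fun i j : Fin 2 => if i.val + j.val + 1 = 2 then (1 : L) else 0)).Local v ×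
      (UnitaryGroup.cmDatum L 1 (Matrix.of fun i j : Fin 1 => if i.val + j.val + 1 = 1 then (1 : L) else 0)).Local v)) [ν.IsHaarMeasure] :
    0 < (ν (UnitaryGroup.cmSplitLeviCompact L v w hw)).toReal := by
  set e₂ := UnitaryGroup.cmSplitEquivTwo L v w hw with he₂
  set e₁ := UnitaryGroup.cmSplitEquivOne L v w hw with he₁
  have hset : (UnitaryGroup.cmSplitLeviCompact L v w hw : Set ((UnitaryGroup.cmDatum L 2 (Matrix.of fun i j : Fin 2 => if i.val + j.val + 1 = 2 then (1 : L) else 0)).Local v ×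
      (UnitaryGroup.cmDatum L 1 (Matrix.of fun i j : Fin 1 => if i.val + j.val + 1 = 1 then (1 : L) else 0)).Local v)) =
      (e₂ ⁻¹' (glInt 2 (w.1.adicCompletion L) : Set (GL (Fin 2) (w.1.adicCompletion L)))) ×ˢ
        (e₁ ⁻¹' (glInt 1 (w.1.adicCompletion L) : Set (GL (Fin 1) (w.1.adicCompletion L)))) := by
    ext x
    rw [SetLike.mem_coe, UnitaryGroup.mem_cmSplitLeviCompact_iff, UnitaryGroup.cmSplitLeviGL_apply]
    exact reindexGL_finSumFinEquiv_blockDiagGL_mem_glInt_iff (k := 2) (l := 1) (e₂ x.1, e₁ x.2)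
  refine ENNReal.toReal_pos ?_ ?_
  · refine (IsOpen.measure_pos ν ?_ ⟨1, (UnitaryGroup.cmSplitLeviCompact L v w hw).one_mem⟩).ne'
    rw [hset]
    exact ((isOpen_glInt 2 (w.1.adicCompletion L)).preimage e₂.continuous).prod ((isOpen_glInt 1 (w.1.adicCompletion L)).preimage e₁.continuous)
  · refine (IsCompact.measure_lt_top ?_).ne
    rw [hset]
    exact (e₂.toHomeomorph.isCompact_preimage.2 (isCompact_glInt 2 (w.1.adicCompletion L))).prod
      (e₁.toHomeomorph.isCompact_preimage.2 (isCompact_glInt 1 (w.1.adicCompletion L)))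

end ConstantTerm

/-! ## §3 `Δ‴_v(γ_{H,v}, γ_{0,v}) = τ_v(γ_{H,v}) · D_{G∕H,v}(γ_{H,v})` with `τ_v(γ_{H,v}) = μ_w(det(e₂ γ_{H,v}.1))` and `D > 0` -/

section Factor

variable (L : Type) [Field L] [NumberField L] [IsCMField L] (H' : Matrix (Fin 3) (Fin 3) L)
  (v : HeightOneSpectrum (𝓞 ↥(maximalRealSubfield L))) (w : UnitaryGroup.PlacesOver L v) (hw : IsCMField.complexConj L • w.1 ≠ w.1)
  (μ : HeckeCharacter L) (hdual : HeckeCharacter.galConj (IsCMField.complexConj L) μ = μ⁻¹)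
  (γ₀ : (UnitaryGroup.cmDatum L 3 H').Rational) (e₁ e₂ : L) (hne : e₁ ≠ e₂)
  (hγ₀ : ((((γ₀ : unitaryGroup (cmConjRingHom L) H').val : GL (Fin 3) L) : Matrix (Fin 3) (Fin 3) L) - e₁ • (1 : Matrix (Fin 3) (Fin 3) L)) *
    ((((γ₀ : unitaryGroup (cmConjRingHom L) H').val : GL (Fin 3) L) : Matrix (Fin 3) (Fin 3) L) - e₂ • (1 : Matrix (Fin 3) (Fin 3) L)) = 0)
  (hchar : (((γ₀ : unitaryGroup (cmConjRingHom L) H').val : GL (Fin 3) L) : Matrix (Fin 3) (Fin 3) L).charpoly =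
    (Polynomial.X - Polynomial.C e₁) ^ 2 * (Polynomial.X - Polynomial.C e₂))
  (γH : (UnitaryGroup.cmDatum L 2 (Matrix.of fun i j : Fin 2 => if i.val + j.val + 1 = 2 then (1 : L) else 0)).Rational ×
    (UnitaryGroup.cmDatum L 1 (Matrix.of fun i j : Fin 1 => if i.val + j.val + 1 = 1 then (1 : L) else 0)).Rational)
  (h₁ : (((γH.1 : unitaryGroup (cmConjRingHom L) (Matrix.of fun i j : Fin 2 => if i.val + j.val + 1 = 2 then (1 : L) else 0)).val : GL (Fin 2) L) :
      Matrix (Fin 2) (Fin 2) L) = e₁ • (1 : Matrix (Fin 2) (Fin 2) L))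
  (h₂ : (((γH.2 : unitaryGroup (cmConjRingHom L) (Matrix.of fun i j : Fin 1 => if i.val + j.val + 1 = 1 then (1 : L) else 0)).val : GL (Fin 1) L) :
      Matrix (Fin 1) (Fin 1) L) 0 0 = e₂)

include w hw hne h₁ h₂ in
/-- **`D_{G∕H,v}(γ_{H,v}) > 0`** at a split place: `= ‖1 − e₁e₂⁻¹‖_w² · ‖e₁e₂⁻¹‖_w⁻¹` (★ `finWeylRatio_eq_of_split_of_scalar` at the block-scalar point `g_w = e₁·1`, `u_w = e₂`),
and `e₁ ≠ e₂`, `e₁e₂ ≠ 0` in the field `L ↪ L_w`. [cite: Rogawski1990, §4.9 p. 55; §4.13 p. 64] -/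
theorem finWeylRatio_singularPair_pos :
    0 < finWeylRatio L v
      ((UnitaryGroup.cmDatum L 2 (Matrix.of fun i j : Fin 2 => if i.val + j.val + 1 = 2 then (1 : L) else 0)).toLocal v
          ((UnitaryGroup.cmDatum L 2 (Matrix.of fun i j : Fin 2 => if i.val + j.val + 1 = 2 then (1 : L) else 0)).toAdelic γH.1),
        (UnitaryGroup.cmDatum L 1 (Matrix.of fun i j : Fin 1 => if i.val + j.val + 1 = 1 then (1 : L) else 0)).toLocal v
          ((UnitaryGroup.cmDatum L 1 (Matrix.of fun i j : Fin 1 => if i.val + j.val + 1 = 1 then (1 : L) else 0)).toAdelic γH.2)) := by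
  -- `e₁ ≠ 0 ≠ e₂` (the components are invertible matrices)
  have he₁ : e₁ ≠ 0 := by
    have hu := Matrix.isUnits_det_units ((γH.1 : unitaryGroup (cmConjRingHom L) (Matrix.of fun i j : Fin 2 => if i.val + j.val + 1 = 2 then (1 : L) else 0)).val : GL (Fin 2) L)
    rw [h₁, Matrix.det_smul, Matrix.det_one, mul_one, Fintype.card_fin] at hu
    exact fun h0 => by rw [h0, zero_pow two_ne_zero] at hu; exact not_isUnit_zero hu
  have he₂ : e₂ ≠ 0 := by
    have hu := Matrix.isUnits_det_units ((γH.2 : unitaryGroup (cmConjRingHom L) (Matrix.of fun i j : Fin 1 => if i.val + j.val + 1 = 1 then (1 : L) else 0)).val : GL (Fin 1) L)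
    rw [Matrix.det_fin_one, h₂] at hu
    exact hu.ne_zero
  have hinj := (algebraMap L (w.1.adicCompletion L)).injective
  have ht₁ : algebraMap L (w.1.adicCompletion L) e₁ ≠ 0 := (map_ne_zero_iff _ hinj).2 he₁
  have ht₂ : algebraMap L (w.1.adicCompletion L) e₂ ≠ 0 := (map_ne_zero_iff _ hinj).2 he₂
  have hg : ((((UnitaryGroup.cmDatum L 2 (Matrix.of fun i j : Fin 2 => if i.val + j.val + 1 = 2 then (1 : L) else 0)).toLocal v
          ((UnitaryGroup.cmDatum L 2 (Matrix.of fun i j : Fin 2 => if i.val + j.val + 1 = 2 then (1 : L) else 0)).toAdelic γH.1)).val.val :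
            Matrix (Fin 2) (Fin 2) (UnitaryGroup.LocalRing L v)).map (fun x => x w)) =
      ((Units.mk0 _ ht₁ : (w.1.adicCompletion L)ˣ) : w.1.adicCompletion L) • (1 : Matrix (Fin 2) (Fin 2) (w.1.adicCompletion L)) := by
    rw [coe_fst_local_eq_smul_one L v γH h₁]
    change (algebraMap L (UnitaryGroup.LocalRing L v) e₁ • (1 : Matrix (Fin 2) (Fin 2) (UnitaryGroup.LocalRing L v))).map
      (Pi.evalRingHom (fun w' : UnitaryGroup.PlacesOver L v => w'.1.adicCompletion L) w) = _
    rw [Matrix.map_smul' _ _ _ (map_mul _), Matrix.map_one _ (map_zero _) (map_one _), Units.val_mk0]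
    rfl
  have ht : finGammaTwo L v
      ((UnitaryGroup.cmDatum L 2 (Matrix.of fun i j : Fin 2 => if i.val + j.val + 1 = 2 then (1 : L) else 0)).toLocal v
          ((UnitaryGroup.cmDatum L 2 (Matrix.of fun i j : Fin 2 => if i.val + j.val + 1 = 2 then (1 : L) else 0)).toAdelic γH.1),
        (UnitaryGroup.cmDatum L 1 (Matrix.of fun i j : Fin 1 => if i.val + j.val + 1 = 1 then (1 : L) else 0)).toLocal v
          ((UnitaryGroup.cmDatum L 1 (Matrix.of fun i j : Fin 1 => if i.val + j.val + 1 = 1 then (1 : L) else 0)).toAdelic γH.2)) w =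
      ((Units.mk0 _ ht₂ : (w.1.adicCompletion L)ˣ) : w.1.adicCompletion L) := by
    rw [finGammaTwo_local_eq L v γH h₂, Units.val_mk0]
    rfl
  rw [finWeylRatio_eq_of_split_of_scalar L v _ w hw _ _ hg ht]
  have hq : ((Units.mk0 _ ht₁ : (w.1.adicCompletion L)ˣ) : w.1.adicCompletion L) * ((Units.mk0 _ ht₂ : (w.1.adicCompletion L)ˣ) : w.1.adicCompletion L)⁻¹ ≠ 0 :=
    mul_ne_zero ht₁ (inv_ne_zero ht₂)
  have h1 : (1 : w.1.adicCompletion L) - ((Units.mk0 _ ht₁ : (w.1.adicCompletion L)ˣ) : w.1.adicCompletion L) *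
      ((Units.mk0 _ ht₂ : (w.1.adicCompletion L)ˣ) : w.1.adicCompletion L)⁻¹ ≠ 0 := by
    rw [Units.val_mk0, Units.val_mk0, sub_ne_zero, ne_comm, Ne, mul_inv_eq_one₀ ht₂, hinj.eq_iff]
    exact hne
  exact mul_pos (pow_pos (norm_pos_iff.2 h1) 2) (inv_pos.2 (norm_pos_iff.2 hq))

include hdual hne hγ₀ hchar h₁ h₂ in
/-- **`Δ‴_v(γ_{H,v}, γ_{0,v}) = μ_w(det(e₂ γ_{H,v}.1)) · D_{G∕H,v}(γ_{H,v})`** at a split place: the pair matches (★ H2 `singularPairIsLocalNormPair`), `χ_g(u) = (e₂ − e₁)²` is a unit,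
so ★ `finExplicitDelta_eq_tau_mul_weyl_of_split` (`Δ‴ = τ · D`, `κ_v = +1`) and ★ `finTau_eq_localComponent_det_of_split` (`τ_v = μ_w ∘ det` of the `w`-component, which is
★ `cmSplitEquivTwo`'s matrix) apply — the SAME character value that ★ `cmSplitTransfer` carries. [cite: Rogawski1990, §4.9 p. 55; §4.13 Lemma 4.13.1 (a) p. 64] -/
theorem finExplicitDelta_singularPair_eq :
    finExplicitDelta L v H'
        ((UnitaryGroup.cmDatum L 2 (Matrix.of fun i j : Fin 2 => if i.val + j.val + 1 = 2 then (1 : L) else 0)).toLocal v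
            ((UnitaryGroup.cmDatum L 2 (Matrix.of fun i j : Fin 2 => if i.val + j.val + 1 = 2 then (1 : L) else 0)).toAdelic γH.1),
          (UnitaryGroup.cmDatum L 1 (Matrix.of fun i j : Fin 1 => if i.val + j.val + 1 = 1 then (1 : L) else 0)).toLocal v
            ((UnitaryGroup.cmDatum L 1 (Matrix.of fun i j : Fin 1 => if i.val + j.val + 1 = 1 then (1 : L) else 0)).toAdelic γH.2))
        μ ((UnitaryGroup.cmDatum L 3 H').toLocal v ((UnitaryGroup.cmDatum L 3 H').toAdelic γ₀)) =
      ((μ.localComponent w.1 (Matrix.GeneralLinearGroup.det (UnitaryGroup.cmSplitEquivTwo L v w hw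
          ((UnitaryGroup.cmDatum L 2 (Matrix.of fun i j : Fin 2 => if i.val + j.val + 1 = 2 then (1 : L) else 0)).toLocal v
            ((UnitaryGroup.cmDatum L 2 (Matrix.of fun i j : Fin 2 => if i.val + j.val + 1 = 2 then (1 : L) else 0)).toAdelic γH.1)))) : ℂˣ) : ℂ) *
        (finWeylRatio L v
          ((UnitaryGroup.cmDatum L 2 (Matrix.of fun i j : Fin 2 => if i.val + j.val + 1 = 2 then (1 : L) else 0)).toLocal v
              ((UnitaryGroup.cmDatum L 2 (Matrix.of fun i j : Fin 2 => if i.val + j.val + 1 = 2 then (1 : L) else 0)).toAdelic γH.1),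
            (UnitaryGroup.cmDatum L 1 (Matrix.of fun i j : Fin 1 => if i.val + j.val + 1 = 1 then (1 : L) else 0)).toLocal v
              ((UnitaryGroup.cmDatum L 1 (Matrix.of fun i j : Fin 1 => if i.val + j.val + 1 = 1 then (1 : L) else 0)).toAdelic γH.2)) : ℂ) := by
  have hnp := K2E4SingularPairIsLocalNormPair.singularPairIsLocalNormPair L H' γ₀ e₁ e₂ hne hγ₀ hchar γH h₁ h₂ v
  have hu := isUnit_eval_finCharpolyTwo_local L v γH hne h₁ h₂
  rw [finExplicitDelta_eq_tau_mul_weyl_of_split L v _ w H' hw μ hnp hu, finTau_eq_localComponent_det_of_split L v _ w μ hw hdual hu]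
  congr 3
  exact Units.ext (by rw [IsUnit.unit_spec, Matrix.GeneralLinearGroup.val_det_apply]; rfl)

end Factor

/-! ## §4 Under the frame, `νH v` is a Haar measure — unless `νH v = 0`, and then every canonical member vanishes -/

section Haar

variable (L : Type) [Field L] [NumberField L] [IsCMField L] (v : HeightOneSpectrum (𝓞 ↥(maximalRealSubfield L)))
  [MeasurableSpace ((UnitaryGroup.cmDatum L 2 (Matrix.of fun i j : Fin 2 => if i.val + j.val + 1 = 2 then (1 : L) else 0)).Local v ×
      (UnitaryGroup.cmDatum L 1 (Matrix.of fun i j : Fin 1 => if i.val + j.val + 1 = 1 then (1 : L) else 0)).Local v)]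
  [BorelSpace ((UnitaryGroup.cmDatum L 2 (Matrix.of fun i j : Fin 2 => if i.val + j.val + 1 = 2 then (1 : L) else 0)).Local v ×
      (UnitaryGroup.cmDatum L 1 (Matrix.of fun i j : Fin 1 => if i.val + j.val + 1 = 1 then (1 : L) else 0)).Local v)]
  (νH : Measure ((UnitaryGroup.cmDatum L 2 (Matrix.of fun i j : Fin 2 => if i.val + j.val + 1 = 2 then (1 : L) else 0)).Local v ×
      (UnitaryGroup.cmDatum L 1 (Matrix.of fun i j : Fin 1 => if i.val + j.val + 1 = 1 then (1 : L) else 0)).Local v))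
  [IsFiniteMeasureOnCompacts νH] [νH.IsMulRightInvariant]

/-- **A NON-ZERO right-invariant Radon measure on `H_v` is a Haar measure** (`H_v = U(Φ₂)_v × U(Φ₁)_v` is unimodular: every Haar measure on it is inversion invariant,
★ `isInvInvariant_localEndoscopic`; ★ `isHaarMeasure_of_isMulRightInvariant_of_ne_zero`). [cite: Folland1999, Thm 11.9] [cite: Rogawski1990, §1.7 p. 6] -/
theorem isHaarMeasure_of_ne_zero (hν : νH ≠ 0) : νH.IsHaarMeasure := by
  haveI : (Measure.haar : Measure ((UnitaryGroup.cmDatum L 2 (Matrix.of fun i j : Fin 2 => if i.val + j.val + 1 = 2 then (1 : L) else 0)).Local v ×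
      (UnitaryGroup.cmDatum L 1 (Matrix.of fun i j : Fin 1 => if i.val + j.val + 1 = 1 then (1 : L) else 0)).Local v)).IsInvInvariant :=
    UnitaryGroup.isInvInvariant_localEndoscopic L v Measure.haar
  haveI : (Measure.haar : Measure ((UnitaryGroup.cmDatum L 2 (Matrix.of fun i j : Fin 2 => if i.val + j.val + 1 = 2 then (1 : L) else 0)).Local v ×
      (UnitaryGroup.cmDatum L 1 (Matrix.of fun i j : Fin 1 => if i.val + j.val + 1 = 1 then (1 : L) else 0)).Local v)).IsMulRightInvariant := by
    rw [← Measure.inv_eq_self (Measure.haar : Measure ((UnitaryGroup.cmDatum L 2 (Matrix.of fun i j : Fin 2 => if i.val + j.val + 1 = 2 then (1 : L) else 0)).Local v ×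
      (UnitaryGroup.cmDatum L 1 (Matrix.of fun i j : Fin 1 => if i.val + j.val + 1 = 1 then (1 : L) else 0)).Local v))]
    infer_instance
  exact isHaarMeasure_of_isMulRightInvariant_of_ne_zero Measure.haar νH hν

variable
  [∀ a : ((UnitaryGroup.cmDatum L 2 (Matrix.of fun i j : Fin 2 => if i.val + j.val + 1 = 2 then (1 : L) else 0)).Local v ×
      (UnitaryGroup.cmDatum L 1 (Matrix.of fun i j : Fin 1 => if i.val + j.val + 1 = 1 then (1 : L) else 0)).Local v),
    MeasurableSpace (((UnitaryGroup.cmDatum L 2 (Matrix.of fun i j : Fin 2 => if i.val + j.val + 1 = 2 then (1 : L) else 0)).Local v ×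
      (UnitaryGroup.cmDatum L 1 (Matrix.of fun i j : Fin 1 => if i.val + j.val + 1 = 1 then (1 : L) else 0)).Local v) ⧸
      Subgroup.centralizer ({a} : Set ((UnitaryGroup.cmDatum L 2 (Matrix.of fun i j : Fin 2 => if i.val + j.val + 1 = 2 then (1 : L) else 0)).Local v ×
      (UnitaryGroup.cmDatum L 1 (Matrix.of fun i j : Fin 1 => if i.val + j.val + 1 = 1 then (1 : L) else 0)).Local v)))]
  [∀ a : ((UnitaryGroup.cmDatum L 2 (Matrix.of fun i j : Fin 2 => if i.val + j.val + 1 = 2 then (1 : L) else 0)).Local v ×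
      (UnitaryGroup.cmDatum L 1 (Matrix.of fun i j : Fin 1 => if i.val + j.val + 1 = 1 then (1 : L) else 0)).Local v),
    BorelSpace (((UnitaryGroup.cmDatum L 2 (Matrix.of fun i j : Fin 2 => if i.val + j.val + 1 = 2 then (1 : L) else 0)).Local v ×
      (UnitaryGroup.cmDatum L 1 (Matrix.of fun i j : Fin 1 => if i.val + j.val + 1 = 1 then (1 : L) else 0)).Local v) ⧸
      Subgroup.centralizer ({a} : Set ((UnitaryGroup.cmDatum L 2 (Matrix.of fun i j : Fin 2 => if i.val + j.val + 1 = 2 then (1 : L) else 0)).Local v ×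
      (UnitaryGroup.cmDatum L 1 (Matrix.of fun i j : Fin 1 => if i.val + j.val + 1 = 1 then (1 : L) else 0)).Local v)))]

/-- **If `νH v = 0`, every `G`-regular stable orbital integral of a CANONICAL family vanishes**: the members at `G`-regular classes are Weil quotients of `νH v`
(★ `IsCanonical`), and the quotient of the zero measure is zero (★ `ne_zero_of_quotientMeasure_ne_zero`); stable conjugates of `G`-regular elements are `G`-regular
(★ `isGRegular_of_isStablyConjH`). [cite: DeitmarEchterhoff2014, Thm. 1.5.3] [cite: Rogawski1990, §4.3 (4.3.1) p. 43] -/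
theorem stableOrbitalIntegralRel_eq_zero_of_measure_eq_zero
    (mH : OrbitalMeasureFamily ((UnitaryGroup.cmDatum L 2 (Matrix.of fun i j : Fin 2 => if i.val + j.val + 1 = 2 then (1 : L) else 0)).Local v ×
      (UnitaryGroup.cmDatum L 1 (Matrix.of fun i j : Fin 1 => if i.val + j.val + 1 = 1 then (1 : L) else 0)).Local v))
    (hcan : mH.IsCanonical (IsLocalGRegular L v) νH) (hν : νH = 0)
    (φ : ((UnitaryGroup.cmDatum L 2 (Matrix.of fun i j : Fin 2 => if i.val + j.val + 1 = 2 then (1 : L) else 0)).Local v ×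
      (UnitaryGroup.cmDatum L 1 (Matrix.of fun i j : Fin 1 => if i.val + j.val + 1 = 1 then (1 : L) else 0)).Local v) → ℂ)
    {γH : ((UnitaryGroup.cmDatum L 2 (Matrix.of fun i j : Fin 2 => if i.val + j.val + 1 = 2 then (1 : L) else 0)).Local v ×
      (UnitaryGroup.cmDatum L 1 (Matrix.of fun i j : Fin 1 => if i.val + j.val + 1 = 1 then (1 : L) else 0)).Local v)}
    (hreg : IsLocalGRegular L v γH) :
    stableOrbitalIntegralRel (IsLocalStablyConjH L v) mH φ γH = 0 := by
  rw [stableOrbitalIntegralRel_def]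
  refine finsum_mem_of_eqOn_zero fun c hc => ?_
  have hreg' : IsLocalGRegular L v (Quotient.out c) := isGRegular_of_isStablyConjH _ _ _ _ hc hreg
  obtain ⟨t, ht, hti, -, hm⟩ := hcan c hreg'
  have hm0 : mH c = 0 := by
    by_contra h
    exact (ne_zero_of_quotientMeasure_ne_zero _ (isClosed_coe_centralizer_singleton (Quotient.out c)) t νH hm h) hν
  rw [classOrbitalIntegral_eq, hm0, orbitalIntegral_zero_measure]
  rfl

/-- **If `νH v = 0` then `(φ, 0)` is a `Δ_v`-transfer pair for EVERY `φ` and EVERY local factor** (both sides of (4.3.1) vanish at each `G`-regular `γ_H`: the left by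
`stableOrbitalIntegralRel_eq_zero_of_measure_eq_zero`, the right because `Φ([γ], 0) = 0`). [cite: Rogawski1990, §4.3 (4.3.1) p. 43] -/
theorem isLocalDeltaTransfer_zero_of_measure_eq_zero {H' : Matrix (Fin 3) (Fin 3) L}
    [∀ γ : (UnitaryGroup.cmDatum L 3 H').Local v,
      MeasurableSpace ((UnitaryGroup.cmDatum L 3 H').Local v ⧸ Subgroup.centralizer ({γ} : Set ((UnitaryGroup.cmDatum L 3 H').Local v)))]
    (mH : OrbitalMeasureFamily ((UnitaryGroup.cmDatum L 2 (Matrix.of fun i j : Fin 2 => if i.val + j.val + 1 = 2 then (1 : L) else 0)).Local v ×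
      (UnitaryGroup.cmDatum L 1 (Matrix.of fun i j : Fin 1 => if i.val + j.val + 1 = 1 then (1 : L) else 0)).Local v))
    (hcan : mH.IsCanonical (IsLocalGRegular L v) νH) (hν : νH = 0) (T : LocalTransferFactor L H' v)
    (mG : OrbitalMeasureFamily ((UnitaryGroup.cmDatum L 3 H').Local v))
    (φ : ((UnitaryGroup.cmDatum L 2 (Matrix.of fun i j : Fin 2 => if i.val + j.val + 1 = 2 then (1 : L) else 0)).Local v ×
      (UnitaryGroup.cmDatum L 1 (Matrix.of fun i j : Fin 1 => if i.val + j.val + 1 = 1 then (1 : L) else 0)).Local v) → ℂ) :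
    IsLocalDeltaTransfer L H' v T mH mG φ 0 := by
  intro a ha
  rw [stableOrbitalIntegralRel_eq_zero_of_measure_eq_zero L v νH mH hcan hν φ ha]
  simp only [classOrbitalIntegral_zero_fun, mul_zero, finsum_zero]

end Haar

section TestFunction

variable (L : Type) [Field L] [NumberField L] [IsCMField L] (v : HeightOneSpectrum (𝓞 ↥(maximalRealSubfield L)))

/-- **At every point of `H_v` there is a test function with value `1`**: the indicator of the translate `x · (U(Φ₂)(𝒪_v) × U(Φ₁)(𝒪_v))` of the standard compact open
subgroup (★ `isCompact_isOpen_cmLocalIntegralLevel`, ★ `isLocSmooth_indicator`). [cite: Rogawski1990, §1.6 p. 6; §4.4 p. 44] -/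
theorem exists_isLocSmooth_apply_eq_one
    (x : (UnitaryGroup.cmDatum L 2 (Matrix.of fun i j : Fin 2 => if i.val + j.val + 1 = 2 then (1 : L) else 0)).Local v ×
      (UnitaryGroup.cmDatum L 1 (Matrix.of fun i j : Fin 1 => if i.val + j.val + 1 = 1 then (1 : L) else 0)).Local v) :
    ∃ φ : ((UnitaryGroup.cmDatum L 2 (Matrix.of fun i j : Fin 2 => if i.val + j.val + 1 = 2 then (1 : L) else 0)).Local v ×
      (UnitaryGroup.cmDatum L 1 (Matrix.of fun i j : Fin 1 => if i.val + j.val + 1 = 1 then (1 : L) else 0)).Local v) → ℂ, IsLocSmooth φ ∧ φ x = 1 := by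
  obtain ⟨hK₂c, hK₂o⟩ := UnitaryGroup.isCompact_isOpen_cmLocalIntegralLevel L 2 (Matrix.of fun i j : Fin 2 => if i.val + j.val + 1 = 2 then (1 : L) else 0) v
  obtain ⟨hK₁c, hK₁o⟩ := UnitaryGroup.isCompact_isOpen_cmLocalIntegralLevel L 1 (Matrix.of fun i j : Fin 1 => if i.val + j.val + 1 = 1 then (1 : L) else 0) v
  set U₀ : Set ((UnitaryGroup.cmDatum L 2 (Matrix.of fun i j : Fin 2 => if i.val + j.val + 1 = 2 then (1 : L) else 0)).Local v ×
      (UnitaryGroup.cmDatum L 1 (Matrix.of fun i j : Fin 1 => if i.val + j.val + 1 = 1 then (1 : L) else 0)).Local v) :=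
    (fun y => x * y) '' ((UnitaryGroup.cmLocalIntegralLevel L 2 (Matrix.of fun i j : Fin 2 => if i.val + j.val + 1 = 2 then (1 : L) else 0) v :
        Set ((UnitaryGroup.cmDatum L 2 (Matrix.of fun i j : Fin 2 => if i.val + j.val + 1 = 2 then (1 : L) else 0)).Local v)) ×ˢ
      (UnitaryGroup.cmLocalIntegralLevel L 1 (Matrix.of fun i j : Fin 1 => if i.val + j.val + 1 = 1 then (1 : L) else 0) v :
        Set ((UnitaryGroup.cmDatum L 1 (Matrix.of fun i j : Fin 1 => if i.val + j.val + 1 = 1 then (1 : L) else 0)).Local v))) with hU₀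
  have hU₀o : IsOpen U₀ := (isOpenMap_mul_left x) _ (hK₂o.prod hK₁o)
  have hU₀c : IsCompact U₀ := (hK₂c.prod hK₁c).image (continuous_const.mul continuous_id)
  have hmem : x ∈ U₀ := ⟨1, ⟨(UnitaryGroup.cmLocalIntegralLevel L 2 _ v).one_mem, (UnitaryGroup.cmLocalIntegralLevel L 1 _ v).one_mem⟩, mul_one _⟩
  exact ⟨U₀.indicator fun _ => (1 : ℂ), isLocSmooth_indicator hU₀o hU₀c.isClosed hU₀c, Set.indicator_of_mem hmem _⟩

end TestFunction

end Summit.HodgeConjecture.HodgeConjecture.Cruxes.H413.K2E4ExplicitSplitConstantPhase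

end
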